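import Summits.KontsevichZagierPeriods.Zeta5Search.LaiSweepShard

/-!
# `κ₃` sweep certificate — shard file 073 of 127 (shards 511–517 of 889)

HONEST FRAMING. Systematic search; no irrationality claim unless certified. This file only checks,
by `decide +kernel`, shards 511–517 of the order-cell sweep of the `κ₃` point `(74, 2180, 444; δ74)`
(engine `LaiSweepEngine`, soundness `LaiSweepJump/Free/Eval/Shard/Kappa3`; a shard is `⟨regime, n,
p, q, p', q', Lo, Up⟩`: `n` cells from `p/q` to `p'/q'` with integer rate sums in `[Lo, Up]`, `K =
128`, `D = 2^40`). It draws NO conclusion: only the capstone `LaiKappa3SweepCert`, which needs all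
127 shard files, does. Kernel cost of this file ≈ 560 cells × 0.3 s.
-/

namespace Summit.KontsevichZagierPeriods.Zeta5Search.Sweep

set_option maxHeartbeats 100000000 in
/-- Shard 511: 80 cells of regime B from `74/141` to `121/230`.
[cite: Lai2024BallRivoal, §4 Lemma 4.3] -/
theorem shard511 :
    Shard.check 128 (2^40)
      ⟨true, 80, 74, 141, 121, 230, 14611582360203, 18141092202851⟩ = true := by
  decide +kernel

set_option maxHeartbeats 100000000 in
/-- Shard 512: 80 cells of regime B from `121/230` to `183/347`.
[cite: Lai2024BallRivoal, §4 Lemma 4.3] -/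
theorem shard512 :
    Shard.check 128 (2^40)
      ⟨true, 80, 121, 230, 183, 347, 14875630902346, 18487326071333⟩ = true := by
  decide +kernel

set_option maxHeartbeats 100000000 in
/-- Shard 513: 80 cells of regime B from `183/347` to `120/227`.
[cite: Lai2024BallRivoal, §4 Lemma 4.3] -/
theorem shard513 :
    Shard.check 128 (2^40)
      ⟨true, 80, 183, 347, 120, 227, 14485992394349, 18020526040597⟩ = true := by
  decide +kernel

set_option maxHeartbeats 100000000 in
/-- Shard 514: 80 cells of regime B from `120/227` to `133/251`.
[cite: Lai2024BallRivoal, §4 Lemma 4.3] -/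
theorem shard514 :
    Shard.check 128 (2^40)
      ⟨true, 80, 120, 227, 133, 251, 14319849862414, 17831223981832⟩ = true := by
  decide +kernel

set_option maxHeartbeats 100000000 in
/-- Shard 515: 80 cells of regime B from `133/251` to `128/241`.
[cite: Lai2024BallRivoal, §4 Lemma 4.3] -/
theorem shard515 :
    Shard.check 128 (2^40)
      ⟨true, 80, 133, 251, 128, 241, 14256362472707, 17768891178273⟩ = true := by
  decide +kernel

set_option maxHeartbeats 100000000 in
/-- Shard 516: 80 cells of regime B from `128/241` to `156/293`.
[cite: Lai2024BallRivoal, §4 Lemma 4.3] -/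
theorem shard516 :
    Shard.check 128 (2^40)
      ⟨true, 80, 128, 241, 156, 293, 14926162626661, 18622056713262⟩ = true := by
  decide +kernel

set_option maxHeartbeats 100000000 in
/-- Shard 517: 80 cells of regime B from `156/293` to `95/178`.
[cite: Lai2024BallRivoal, §4 Lemma 4.3] -/
theorem shard517 :
    Shard.check 128 (2^40)
      ⟨true, 80, 156, 293, 95, 178, 14708952790921, 18369814998708⟩ = true := by
  decide +kernel

/-- The checked shards of this file, in order. [folklore] -/
def shards073 : List (CheckedShard 128 (2^40)) :=
  [⟨_, shard511⟩, ⟨_, shard512⟩, ⟨_, shard513⟩, ⟨_, shard514⟩, ⟨_, shard515⟩,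
    ⟨_, shard516⟩, ⟨_, shard517⟩]

end Summit.KontsevichZagierPeriods.Zeta5Search.Sweep
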